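import Mathlib
import Summits.ResolutionOfSingularities.ResolutionOfSingularities.Theorems.RisoStrataRisoCentresResolvePlumbing
import Literature.AlgebraicGeometry.Resolution.ZariskiRiemannSpace

/-!
# Route RisoStrata — crux `RisoCentresResolve` (stmt-ResolutionOfSingularities-18546),
# line `Sketch`: stub `stub_rcrTransfer` (Zariski–Riemann compactness transfer)

From local uniformization along a fixed infinite word `w` — every valuation ring `O ⊇ k` of `K`
admits an initial chart `k[hᵢ/hⱼ] ⊆ O` and admissible denominators `x` such that the tower
`B_{s+1} = risoStep P B_s (w s) (x s)` is regular at the centre of `O` at SOME stage `t` —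
together with persistence of regularity, path independence of the local ring at the centre and
the neighbourhood property of regularity (all four are hypotheses here, supplied by the other stubs
of the line), we produce ONE length `T` good for every `O`, every initial chart and every
admissible choice of denominators.

Proof sketch.
* Stage `s ≤ t` of the tower along the word cut at length `t` is stage `s` along the word cut at
  length `s` (`transfer_stage_eq`): all stages are canonical, they increase with `s`, stay in `O`
  along admissible denominators, and `B_{s+1} = risoStep P B_s (w s) (x s)`.
* For `t : ℕ`, a finitely generated start `B₀` and denominators `x`, the set of points `O_v` of
  the Zariski–Riemann space `Zar(K/k)` with `B₀ ⊆ O_v`, `x` admissible for `O_v` below `t` and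
  `risoLoc O_v B_t` regular is open (`transfer_isOpen`): `B_t = k[g₁, …, gₘ]` is finitely
  generated, `regNbhd` gives `f ∈ B_t` with `f⁻¹ ∈ O_v` spreading regularity to every
  `O' ⊇ B_t ∋ f⁻¹`, and `E(g₁) ∩ ⋯ ∩ E(gₘ) ∩ E(f⁻¹)` is an open neighbourhood of `v` inside the
  set, because admissibility for `O'` only asks `Cen_s · (x s)⁻¹ ⊆ B_{s+1} ⊆ B_t ⊆ O'`.
* By `localUnif` these sets, indexed by `(t, j, x)`, cover `Zar(K/k)`, which is quasi-compact
  (`ZariskiRiemannSpace.compactSpace`, Zariski 1944): finitely many suffice; let `T` be the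
  largest `t` occurring.
* Given `O`, a chart `j'` and denominators `x'` admissible below `T`, the point `O` lies in the
  set of some `(t, j, x)` with `t ≤ T`; by `risoLoc_chart_eq` and `pathIndep` the paths `(j, x)`
  and `(j', x')` have the same local ring at the centre of `O` at every stage `s ≤ t`
  (`transfer_loc_eq`), so `(j', x')` is regular at stage `t`, and `persist` carries regularity
  from `t` up to `T` (`transfer_persist`).
-/

noncomputable section

set_option linter.dupNamespace false -- mandated namespace of this single-conjunct summit

namespace Summit.ResolutionOfSingularities.ResolutionOfSingularities.Theorems

open Literature.AlgebraicGeometry.Resolution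

variable {k K : Type} [Field k] [Field K] [Algebra k K]

/-! ## The tower along a word: canonical stages -/

/-- Up to stage `s`, the tower along the word `w` cut at length `t ≥ s` is the tower along the
word cut at length `s`. [folklore] -/
theorem transfer_stage_eq (P : ∀ B : Subalgebra k K, Ideal ↥B → ℕ → Prop) (B₀ : Subalgebra k K)
    (w : ℕ → ℕ) (x : ℕ → K) {s t : ℕ} (hst : s ≤ t) :
    risoStage P B₀ ((List.range t).map w) x s = risoStage P B₀ ((List.range s).map w) x s := by
  rw [← risoStage_take P B₀ ((List.range t).map w) x (le_refl s), ← List.map_take,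
    List.take_range, Nat.min_eq_left hst]

/-- The `s`-th letter of the word cut at length `t > s` is `w s`. [folklore] -/
theorem transfer_getD (w : ℕ → ℕ) {s t : ℕ} (hst : s < t) :
    ((List.range t).map w).getD s 0 = w s := by
  rw [List.getD_eq_getElem?_getD, List.getElem?_map, List.getElem?_range hst]
  rfl

/-- Admissibility at stage `s < t` along the word cut at `t` is admissibility along the word cut
at `s`. [folklore] -/
theorem transfer_valid_iff (P : ∀ B : Subalgebra k K, Ideal ↥B → ℕ → Prop)
    (O : ValuationSubring K) (B₀ : Subalgebra k K) (w : ℕ → ℕ) (x : ℕ → K) {s t : ℕ}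
    (hst : s ≤ t) :
    risoValid P O (risoStage P B₀ ((List.range t).map w) x s) (w s) (x s) ↔
      risoValid P O (risoStage P B₀ ((List.range s).map w) x s) (w s) (x s) := by
  rw [transfer_stage_eq P B₀ w x hst]

/-- **Successor formula along a word**: stage `s + 1` is the chart of stage `s` in direction
`w s` with denominator `x s`. [folklore] -/
theorem transfer_stage_succ (P : ∀ B : Subalgebra k K, Ideal ↥B → ℕ → Prop)
    (B₀ : Subalgebra k K) (w : ℕ → ℕ) (x : ℕ → K) (s : ℕ) :
    risoStage P B₀ ((List.range (s + 1)).map w) x (s + 1) =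
      risoStep P (risoStage P B₀ ((List.range s).map w) x s) (w s) (x s) := by
  rw [risoStage_succ P B₀ ((List.range (s + 1)).map w) x (by simp),
    transfer_stage_eq P B₀ w x (Nat.le_succ s), transfer_getD w (Nat.lt_succ_self s)]

/-- The canonical stages increase. [folklore] -/
theorem transfer_stage_mono (P : ∀ B : Subalgebra k K, Ideal ↥B → ℕ → Prop)
    (B₀ : Subalgebra k K) (w : ℕ → ℕ) (x : ℕ → K) {s t : ℕ} (hst : s ≤ t) :
    risoStage P B₀ ((List.range s).map w) x s ≤ risoStage P B₀ ((List.range t).map w) x t := by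
  rw [← transfer_stage_eq P B₀ w x hst]
  exact risoStage_mono P B₀ _ x hst

/-- **Admissible towers along a word stay inside `O`.** [folklore] -/
theorem transfer_stage_le {P : ∀ B : Subalgebra k K, Ideal ↥B → ℕ → Prop}
    {O : ValuationSubring K} {B₀ : Subalgebra k K} (hB₀ : B₀.toSubring ≤ O.toSubring)
    (w : ℕ → ℕ) (x : ℕ → K) {t : ℕ}
    (hadm : ∀ s, s < t →
      risoValid P O (risoStage P B₀ ((List.range s).map w) x s) (w s) (x s)) :
    (risoStage P B₀ ((List.range t).map w) x t).toSubring ≤ O.toSubring :=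
  risoStage_toSubring_le hB₀ fun s hs _ => by
    rw [transfer_stage_eq P B₀ w x hs.le, transfer_getD w hs]
    exact hadm s hs

/-- The new generators `a · (x s)⁻¹`, `a ∈ Cen_s`, of stage `s + 1` lie in every later stage.
[folklore] -/
theorem transfer_mul_inv_mem (P : ∀ B : Subalgebra k K, Ideal ↥B → ℕ → Prop)
    (B₀ : Subalgebra k K) (w : ℕ → ℕ) (x : ℕ → K) {s t : ℕ} (hst : s < t)
    {a : ↥(risoStage P B₀ ((List.range s).map w) x s)}
    (ha : a ∈ risoCen P (risoStage P B₀ ((List.range s).map w) x s) (w s)) :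
    (a : K) * (x s)⁻¹ ∈ risoStage P B₀ ((List.range t).map w) x t := by
  apply transfer_stage_mono P B₀ w x (Nat.succ_le_of_lt hst)
  rw [transfer_stage_succ]
  exact mul_inv_mem_risoStep P ha

/-- **Admissibility spreads**: a denominator admissible for `O` at stage `s < t` is admissible for
every valuation ring containing stage `t`. [folklore] -/
theorem transfer_valid_of_le {P : ∀ B : Subalgebra k K, Ideal ↥B → ℕ → Prop}
    {O O' : ValuationSubring K} {B₀ : Subalgebra k K} (w : ℕ → ℕ) (x : ℕ → K) {s t : ℕ}
    (hst : s < t) (hO' : (risoStage P B₀ ((List.range t).map w) x t).toSubring ≤ O'.toSubring)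
    (hV : risoValid P O (risoStage P B₀ ((List.range s).map w) x s) (w s) (x s)) :
    risoValid P O' (risoStage P B₀ ((List.range s).map w) x s) (w s) (x s) :=
  ⟨hV.1, hV.2.1, fun _ ha => hO' (transfer_mul_inv_mem P B₀ w x hst ha)⟩

/-! ## Openness in the Zariski–Riemann space -/

/-- **The set of valuation rings for which a given path is admissible below `t` and regular at
stage `t` is open** in `Zar(K/k)`: with `B_t = k[g₁, …, gₘ]` and `f` as in the neighbourhood
property, `E(g₁) ∩ ⋯ ∩ E(gₘ) ∩ E(f⁻¹)` is an open neighbourhood inside it. [folklore] -/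
theorem transfer_isOpen (P : ∀ B : Subalgebra k K, Ideal ↥B → ℕ → Prop)
    (regNbhd : ∀ (O : ValuationSubring K) (B : Subalgebra k K), B.FG →
      B.toSubring ≤ O.toSubring → IsRegularLocalRing ↥(risoLoc O B) →
        ∃ f : K, f ∈ B ∧ f⁻¹ ∈ O ∧ ∀ O' : ValuationSubring K, B.toSubring ≤ O'.toSubring →
          f⁻¹ ∈ O' → IsRegularLocalRing ↥(risoLoc O' B))
    {B₀ : Subalgebra k K} (hB₀ : B₀.FG) (w : ℕ → ℕ) (x : ℕ → K) (t : ℕ) :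
    IsOpen {v : ZariskiRiemannSpace k K |
      B₀.toSubring ≤ v.asValuationSubring.toSubring ∧
        (∀ s, s < t → risoValid P v.asValuationSubring
          (risoStage P B₀ ((List.range s).map w) x s) (w s) (x s)) ∧
        IsRegularLocalRing ↥(risoLoc v.asValuationSubring
          (risoStage P B₀ ((List.range t).map w) x t))} := by
  refine isOpen_iff_forall_mem_open.mpr ?_
  rintro v ⟨hle, hadm, hreg⟩
  have hfg : (risoStage P B₀ ((List.range t).map w) x t).FG := risoStage_fg hB₀ t
  have hBtO : (risoStage P B₀ ((List.range t).map w) x t).toSubring ≤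
      v.asValuationSubring.toSubring :=
    transfer_stage_le hle w x hadm
  obtain ⟨f, -, hfO, hf⟩ := regNbhd _ _ hfg hBtO hreg
  obtain ⟨G, hG⟩ := hfg
  refine ⟨(⋂ g ∈ G, ZariskiRiemannSpace.basicOpen g) ∩ ZariskiRiemannSpace.basicOpen f⁻¹,
    ?_, ?_, ?_⟩
  · rintro v' ⟨hvG, hvf⟩
    -- `B_t = k[G] ⊆ O'`
    have hBtO' : (risoStage P B₀ ((List.range t).map w) x t).toSubring ≤
        v'.asValuationSubring.toSubring := by
      let O'k : Subalgebra k K :=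
        { v'.asValuationSubring.toSubring with algebraMap_mem' := v'.algebraMap_mem' }
      have hle' : risoStage P B₀ ((List.range t).map w) x t ≤ O'k := by
        rw [← hG]
        exact Algebra.adjoin_le fun g hg => Set.mem_iInter₂.mp hvG g hg
      exact fun y hy => hle' hy
    exact ⟨fun y hy => hBtO' (le_risoStage P B₀ _ x t hy),
      fun s hs => transfer_valid_of_le w x hs hBtO' (hadm s hs), hf _ hBtO' hvf⟩
  · exact (isOpen_biInter_finset fun g _ => ZariskiRiemannSpace.isOpen_basicOpen g).inter
      (ZariskiRiemannSpace.isOpen_basicOpen _)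
  · exact ⟨Set.mem_iInter₂.mpr fun g hg =>
      hBtO (show g ∈ risoStage P B₀ ((List.range t).map w) x t from hG ▸ Algebra.subset_adjoin hg),
      hfO⟩

/-! ## Comparison of paths and persistence along a word -/

/-- **Two admissible paths from starts with the same local ring at the centre of `O` have the same
local ring at every stage**, by path independence and induction on the stage. [folklore] -/
theorem transfer_loc_eq (P : ∀ B : Subalgebra k K, Ideal ↥B → ℕ → Prop)
    (pathIndep : ∀ (O : ValuationSubring K) (B B' : Subalgebra k K), B.FG → B'.FG →
      B.toSubring ≤ O.toSubring → B'.toSubring ≤ O.toSubring → risoLoc O B = risoLoc O B' →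
        ∀ (d : ℕ) (xt xt' : K), risoValid P O B d xt → risoValid P O B' d xt' →
          risoLoc O (risoStep P B d xt) = risoLoc O (risoStep P B' d xt'))
    {O : ValuationSubring K} {B₀ B₀' : Subalgebra k K} (hB₀ : B₀.FG) (hB₀' : B₀'.FG)
    (hle : B₀.toSubring ≤ O.toSubring) (hle' : B₀'.toSubring ≤ O.toSubring)
    (h0 : risoLoc O B₀ = risoLoc O B₀') (w : ℕ → ℕ) (x x' : ℕ → K) {t : ℕ}
    (hadm : ∀ s, s < t →
      risoValid P O (risoStage P B₀ ((List.range s).map w) x s) (w s) (x s))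
    (hadm' : ∀ s, s < t →
      risoValid P O (risoStage P B₀' ((List.range s).map w) x' s) (w s) (x' s)) :
    risoLoc O (risoStage P B₀ ((List.range t).map w) x t) =
      risoLoc O (risoStage P B₀' ((List.range t).map w) x' t) := by
  induction t with
  | zero => simpa using h0
  | succ t ih =>
    have ht : ∀ s, s < t → s < t + 1 := fun s hs => hs.trans (Nat.lt_succ_self t)
    rw [transfer_stage_succ, transfer_stage_succ]
    exact pathIndep O _ _ (risoStage_fg hB₀ t) (risoStage_fg hB₀' t)
      (transfer_stage_le hle w x fun s hs => hadm s (ht s hs))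
      (transfer_stage_le hle' w x' fun s hs => hadm' s (ht s hs))
      (ih (fun s hs => hadm s (ht s hs)) fun s hs => hadm' s (ht s hs))
      (w t) (x t) (x' t) (hadm t (Nat.lt_succ_self t)) (hadm' t (Nat.lt_succ_self t))

/-- **Persistence along a word**: an admissible path regular at stage `t` is regular at every
later stage `T`. [folklore] -/
theorem transfer_persist (P : ∀ B : Subalgebra k K, Ideal ↥B → ℕ → Prop)
    (persist : ∀ (O : ValuationSubring K) (B : Subalgebra k K), B.FG →
      B.toSubring ≤ O.toSubring → ∀ (d : ℕ) (xt : K), risoValid P O B d xt →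
        IsRegularLocalRing ↥(risoLoc O B) → risoLoc O (risoStep P B d xt) = risoLoc O B)
    {O : ValuationSubring K} {B₀ : Subalgebra k K} (hB₀ : B₀.FG)
    (hle : B₀.toSubring ≤ O.toSubring) (w : ℕ → ℕ) (x : ℕ → K) {t T : ℕ} (htT : t ≤ T)
    (hadm : ∀ s, s < T →
      risoValid P O (risoStage P B₀ ((List.range s).map w) x s) (w s) (x s))
    (hreg : IsRegularLocalRing ↥(risoLoc O (risoStage P B₀ ((List.range t).map w) x t))) :
    IsRegularLocalRing ↥(risoLoc O (risoStage P B₀ ((List.range T).map w) x T)) := by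
  induction htT with
  | refl => exact hreg
  | @step n htn ih =>
    have hn : ∀ s, s < n →
        risoValid P O (risoStage P B₀ ((List.range s).map w) x s) (w s) (x s) :=
      fun s hs => hadm s (Nat.lt_succ_of_lt hs)
    have hregn := ih hn
    rw [transfer_stage_succ, persist O _ (risoStage_fg hB₀ n) (transfer_stage_le hle w x hn)
      (w n) (x n) (hadm n (Nat.lt_succ_self n)) hregn]
    exact hregn

/-! ## The transfer -/

/-- Stub `stub_rcrTransfer` of crux `RisoCentresResolve`, line `Sketch`: **Zariski–Riemann
compactness transfer.** Local uniformization along a fixed word `w` (for every valuation ring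
`O ⊇ k` some admissible path from some chart `k[hᵢ/hⱼ] ⊆ O` is regular at the centre of `O` at
some stage), persistence of regularity, path independence of the local ring at the centre and
the neighbourhood property of regularity yield ONE length `T` such that every admissible path of
length `T` from every chart containing the centre of every `O` ends regular at the centre of `O`:
the sets `{O : some admissible path is regular at stage t}` are open in the quasi-compact
Zariski–Riemann space `Zar(K/k)` (`ZariskiRiemannSpace.compactSpace`), so finitely many `t`
suffice; path independence moves regularity to any other admissible path at the same stage and
persistence carries it up to `T`. [folklore] -/
theorem stub_rcrTransfer {k K : Type} [Field k] [IsAlgClosed k] [Field K] [Algebra k K]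
    (P : ∀ B : Subalgebra k K, Ideal ↥B → ℕ → Prop) (N : ℕ) (h : Fin (N + 1) → K)
    (hh : ∀ i, h i ≠ 0) (w : ℕ → ℕ)
    (persist : ∀ (O : ValuationSubring K) (B : Subalgebra k K), B.FG →
      B.toSubring ≤ O.toSubring → ∀ (d : ℕ) (xt : K), risoValid P O B d xt →
        IsRegularLocalRing ↥(risoLoc O B) → risoLoc O (risoStep P B d xt) = risoLoc O B)
    (pathIndep : ∀ (O : ValuationSubring K) (B B' : Subalgebra k K), B.FG → B'.FG →
      B.toSubring ≤ O.toSubring → B'.toSubring ≤ O.toSubring → risoLoc O B = risoLoc O B' →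
        ∀ (d : ℕ) (xt xt' : K), risoValid P O B d xt → risoValid P O B' d xt' →
          risoLoc O (risoStep P B d xt) = risoLoc O (risoStep P B' d xt'))
    (regNbhd : ∀ (O : ValuationSubring K) (B : Subalgebra k K), B.FG →
      B.toSubring ≤ O.toSubring → IsRegularLocalRing ↥(risoLoc O B) →
        ∃ f : K, f ∈ B ∧ f⁻¹ ∈ O ∧ ∀ O' : ValuationSubring K, B.toSubring ≤ O'.toSubring →
          f⁻¹ ∈ O' → IsRegularLocalRing ↥(risoLoc O' B))
    (localUnif : ∀ O : ValuationSubring K, (∀ c : k, algebraMap k K c ∈ O) →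
      ∃ (j : Fin (N + 1)) (x : ℕ → K) (t : ℕ), (∀ i, h i * (h j)⁻¹ ∈ O) ∧
        (∀ s, s < t → risoValid P O
          (risoStage P (Algebra.adjoin k (Set.range fun i => h i * (h j)⁻¹))
            ((List.range t).map w) x s) (w s) (x s)) ∧
        IsRegularLocalRing ↥(risoLoc O
          (risoStage P (Algebra.adjoin k (Set.range fun i => h i * (h j)⁻¹))
            ((List.range t).map w) x t))) :
    ∃ T : ℕ, ∀ O : ValuationSubring K, (∀ c : k, algebraMap k K c ∈ O) →
      ∀ j : Fin (N + 1), (∀ i, h i * (h j)⁻¹ ∈ O) → ∀ x : ℕ → K,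
        (∀ s, s < T → risoValid P O
          (risoStage P (Algebra.adjoin k (Set.range fun i => h i * (h j)⁻¹))
            ((List.range T).map w) x s) (w s) (x s)) →
        IsRegularLocalRing ↥(risoLoc O
          (risoStage P (Algebra.adjoin k (Set.range fun i => h i * (h j)⁻¹))
            ((List.range T).map w) x T)) := by
  -- the charts `k[hᵢ/hⱼ : i]` are finitely generated
  have hfg : ∀ j : Fin (N + 1), (Algebra.adjoin k (Set.range fun i => h i * (h j)⁻¹)).FG :=
    fun j => Subalgebra.fg_def.mpr ⟨_, Set.finite_range _, rfl⟩
  -- the open sets `U (t, j, x)` of `transfer_isOpen` cover the quasi-compact space `Zar(K/k)`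
  obtain ⟨F, hF⟩ := (isCompact_univ (X := ZariskiRiemannSpace k K)).elim_finite_subcover _
    (fun i : ℕ × Fin (N + 1) × (ℕ → K) => transfer_isOpen P regNbhd (hfg i.2.1) w i.2.2 i.1)
    fun v _ => by
      obtain ⟨j, x, t, hj, hadm, hreg⟩ := localUnif v.asValuationSubring v.algebraMap_mem'
      exact Set.mem_iUnion.mpr ⟨(t, j, x), chart_toSubring_le v.algebraMap_mem' h j hj,
        fun s hs => (transfer_valid_iff P _ _ w x hs.le).mp (hadm s hs), hreg⟩
  -- `T` := the largest stage index of the finite subcover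
  suffices key : ∀ (v : ZariskiRiemannSpace k K) (j : Fin (N + 1)) (x : ℕ → K),
      (Algebra.adjoin k (Set.range fun i => h i * (h j)⁻¹)).toSubring ≤
          v.asValuationSubring.toSubring →
        (∀ s, s < F.sup (fun i => i.1) → risoValid P v.asValuationSubring
          (risoStage P (Algebra.adjoin k (Set.range fun i => h i * (h j)⁻¹))
            ((List.range s).map w) x s) (w s) (x s)) →
        IsRegularLocalRing ↥(risoLoc v.asValuationSubring
          (risoStage P (Algebra.adjoin k (Set.range fun i => h i * (h j)⁻¹))
            ((List.range (F.sup fun i => i.1)).map w) x (F.sup fun i => i.1))) by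
    exact ⟨F.sup fun i => i.1, fun O hk j hj x hadm => key ⟨O, hk⟩ j x
      (chart_toSubring_le hk h j hj) fun s hs =>
        (transfer_valid_iff P _ _ w x hs.le).mp (hadm s hs)⟩
  intro v j' x' hj' hadm'
  -- the point `v` lies in some `U (t, j, x)` with `t ≤ T`
  obtain ⟨i, hiF, hle, hadm, hreg⟩ := Set.mem_iUnion₂.mp (hF (Set.mem_univ v))
  have hiT : i.1 ≤ F.sup (fun i => i.1) := F.le_sup (f := fun i => i.1) hiF
  -- (a) the paths `(j, x)` and `(j', x')` have the same local ring at stage `t`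
  have hjO : ∀ i', h i' * (h i.2.1)⁻¹ ∈ v.asValuationSubring := fun i' =>
    hle (Algebra.subset_adjoin ⟨i', rfl⟩)
  have hj'O : ∀ i', h i' * (h j')⁻¹ ∈ v.asValuationSubring := fun i' =>
    hj' (Algebra.subset_adjoin ⟨i', rfl⟩)
  have heq := transfer_loc_eq P pathIndep (hfg i.2.1) (hfg j') hle hj'
    (risoLoc_chart_eq v.algebraMap_mem' h hh i.2.1 j' hjO hj'O) w i.2.2 x' hadm
    fun s hs => hadm' s (lt_of_lt_of_le hs hiT)
  rw [heq] at hreg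
  -- (b) persistence from `t` up to `T`
  exact transfer_persist P persist (hfg j') hj' w x' hiT hadm' hreg

end Summit.ResolutionOfSingularities.ResolutionOfSingularities.Theorems

end
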